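import Summits.Ventures.HSemireg.WedgeHankelRecurrenceRouthHurwitz
import Summits.Ventures.HSemireg.WedgeHankelRecurrenceJacobi

/-!
# Venture HSemireg — HERMITE'S COUNT BY DETERMINANTS: for a real polynomial `p` of degree `n` whose Hermite determinants `D_k = det H_k(p)` (leading minors of the Hermite–Fujiwara matrix) are all
# non-zero, **the number of roots in `Re z > 0` is the number of sign VARIATIONS and the number of roots in `Re z < 0` the number of sign PERMANENCES in `1 = D_0, D_1, …, D_n`** — Hermite's
# theorem (F–H Thm 5.52 ∕ BPR Thm 9.31: the inertia of `H_n(p)` counts the roots by half-plane, N187) read through JACOBI'S RULE (the tree's `WedgeHankelRecurrenceJacobi`: signature from the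
# signs of the leading minors); the Hermite-matrix twin of the Routh–Hurwitz count (34′) (N218)

HONEST FRAMING. Part of the Lean index of the computation cell `pub-hsemireg` (seat p10 gen 39, Sunday typer «UNIFORM-IN-n»).  An assembly of two tree theorems (N187 real Hermite inertia, the gen-34
Jacobi rule `WedgeHankelRecurrenceJacobi`); no variety, no cohomology theory, no sheaf, no Ext group and no semiregularity map is constructed here; nothing here says that HC / HC_CM / HC_AV holds; no Literature fact
(unproved `Prop`) is declared or used.  Custodian versions as in `WedgeHankelSiegelIdeal` (1/3).
SOURCES (cited).  C. Hermite (1856); C. G. J. Jacobi (1857); Fuhrmann–Helmke (2015) Thm 5.52 (inertia of `H_n(p)` = numbers of roots in the two half-planes); Gantmacher I Ch. X §3 (Jacobi's rule) and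
II Ch. XV §6 (34′) (the Hurwitz-determinant twin); BPR Thm 9.31.
DEDUP DISCLOSURE (`rg`, 2026-09-02): N187 `sigPos_hermiteFujiwara_real ∕ sigNeg_hermiteFujiwara_real` (counts = inertia), N186 `isCoprime_of_det_hermiteFujiwara_ne_zero`, Jacobi file
`sigPos_sigNeg_eq_card_filter_det_mul_det` (symmetric tables) — the determinant COUNT for `H_k(p)` is not stated anywhere.  The 3 names below: 0 hits tree-wide.

WHAT IS IN THE TREE.  N183: `hermiteFujiwara`, `hermiteFujiwara_apply_of_trivialStar`, `hermiteFujiwara_isSymm`; N186: `isCoprime_of_det_hermiteFujiwara_ne_zero`; N187: `hermiteFujiwara_map_ofReal`,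
`isCoprime_map_ofReal_iff`, `sigPos_hermiteFujiwara_real`, `sigNeg_hermiteFujiwara_real`; Jacobi (gen 34): `sigPos_sigNeg_eq_card_filter_det_mul_det`; Literature `Bezoutian.bezCoeff_comm`.  Mathlib:
`RingHom.map_det`.
THIS FILE (namespace `Summit.Ventures.HSemireg.Wedge.HankelOuter` continued; PLAIN over N187 + Jacobi; 0 definitions):
* §948 `hermiteFujiwara_eq_of_table` (`H_k(p)` is the `k × k` block of ONE symmetric table), `isCoprime_comp_neg_X_of_det_hermiteFujiwara_ne_zero` (`D_n ≠ 0 ⇒ p ⊥ p(−X)`, real `p`),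
  **`countP_re_eq_card_filter_det_hermiteFujiwara`** (`deg p = n`, all `D_k ≠ 0`: `#{Re<0} = #{k<n : D_kD_{k+1} > 0}` and `#{Re>0} = #{k<n : D_kD_{k+1} < 0}`).
CAVEATS.  Real coefficients (the tree's Jacobi rule is for symmetric tables over an ordered field; the complex-Hermitian version would need its Hermitian twin).  Regular case `D_k ≠ 0`.  Nothing
Ext-side.  New names only.
-/

open Module Polynomial
open scoped Matrix Polynomial

namespace Summit.Ventures.HSemireg.Wedge.HankelOuter

open Summit.Ventures.HSemireg.Wedge Summit.Ventures.HSemireg.Wedge.Hankel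
open Literature.LinearAlgebra.Matrix.Bezoutian (bezCoeff bezCoeff_comm)

/-! ## §948. Hermite's determinants count the roots by half-plane -/

/-- `H_k(p)` (real `p`) is the `k × k` block of the single table `(i, j) ↦ (−1)^j b_{ij}(p(−X), p)`. [bookkeeping; this file, §948] -/
theorem hermiteFujiwara_eq_of_table (k : ℕ) (p : ℝ[X]) :
    hermiteFujiwara k p = Matrix.of fun i j : Fin k => (fun a b : ℕ => (-1 : ℝ) ^ b * bezCoeff (p.comp (-Polynomial.X)) p a b) i j := by
  ext i j
  rw [Matrix.of_apply, hermiteFujiwara_apply_of_trivialStar]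

/-- **`det H_n(p) ≠ 0 ⇒ p ⊥ p(−X)`** for a real `p` of degree `n ≥ 1` (N186 over `ℂ`, transported by `H_n(p)^ℂ = H_n(p_ℂ)` and N187's coprimality dictionary). [F–H Thm 5.53 proof; this file, §948] -/
theorem isCoprime_comp_neg_X_of_det_hermiteFujiwara_ne_zero {n : ℕ} {p : ℝ[X]} (hp : p.natDegree = n) (hp0 : p ≠ 0) (hdet : (hermiteFujiwara n p).det ≠ 0) :
    IsCoprime p (p.comp (-Polynomial.X)) := by
  rw [← isCoprime_map_ofReal_iff]
  refine isCoprime_of_det_hermiteFujiwara_ne_zero (by rw [natDegree_map_eq_of_injective (RingHom.injective _), hp]) ((Polynomial.map_ne_zero_iff (RingHom.injective _)).2 hp0) ?_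
  rw [← hermiteFujiwara_map_ofReal, ← RingHom.mapMatrix_apply, ← RingHom.map_det]
  exact (_root_.map_ne_zero _).2 hdet

/-- **HERMITE'S COUNT BY DETERMINANTS: for a real `p` of degree `n` with `D_k = det H_k(p) ≠ 0` for all `k ≤ n`, `#{Re z < 0} = #{k < n : D_k D_{k+1} > 0}` and `#{Re z > 0} = #{k < n : D_k D_{k+1} < 0}`**
(`D_0 = 1`; roots in `ℂ` with multiplicity): F–H Thm 5.52 (inertia of `H_n(p)`, N187) + Jacobi's rule. [Hermite 1856 ∕ Jacobi 1857; F–H Thm 5.52; Gantmacher I Ch. X §3; this file, §948] -/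
theorem countP_re_eq_card_filter_det_hermiteFujiwara {n : ℕ} {p : ℝ[X]} (hp : p.natDegree = n) (hD : ∀ k ≤ n, (hermiteFujiwara k p).det ≠ 0) :
    (p.map (algebraMap ℝ ℂ)).roots.countP (fun z : ℂ => z.re < 0) = ((Finset.range n).filter fun k => 0 < (hermiteFujiwara k p).det * (hermiteFujiwara (k + 1) p).det).card
      ∧ (p.map (algebraMap ℝ ℂ)).roots.countP (fun z : ℂ => 0 < z.re) = ((Finset.range n).filter fun k => (hermiteFujiwara k p).det * (hermiteFujiwara (k + 1) p).det < 0).card := by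
  rcases n with _ | n
  · rw [eq_C_of_natDegree_eq_zero hp, Polynomial.map_C, roots_C]
    simp
  have hp0 : p ≠ 0 := by rintro rfl; rw [natDegree_zero] at hp; omega
  have hcop := isCoprime_comp_neg_X_of_det_hermiteFujiwara_ne_zero hp hp0 (hD (n + 1) le_rfl)
  have hS : ∀ a b : ℕ, (fun a b : ℕ => (-1 : ℝ) ^ b * bezCoeff (p.comp (-Polynomial.X)) p a b) a b = (fun a b : ℕ => (-1 : ℝ) ^ b * bezCoeff (p.comp (-Polynomial.X)) p a b) b a := fun a b => by
    have h := hermiteFujiwara_isSymm (max a b + 1) p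
    have hab := congrFun (congrFun h ⟨a, by omega⟩) ⟨b, by omega⟩
    rw [Matrix.transpose_apply, hermiteFujiwara_apply_of_trivialStar, hermiteFujiwara_apply_of_trivialStar] at hab
    exact hab.symm
  obtain ⟨hP, hN⟩ := sigPos_sigNeg_eq_card_filter_det_mul_det hS (n + 1) fun k hk => by rw [← hermiteFujiwara_eq_of_table]; exact hD k hk
  simp only [← hermiteFujiwara_eq_of_table] at hP hN
  rw [sigPos_hermiteFujiwara_real hp hcop] at hP
  rw [sigNeg_hermiteFujiwara_real hp hcop] at hN
  exact ⟨hP, hN⟩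

end Summit.Ventures.HSemireg.Wedge.HankelOuter
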